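import Literature.Analysis.FluidPDE.OnsagerBDSVEulerApriori
import HarnessLib

/-!
# The BDSV gluing stage: stability of the exact solutions relative to `v_ℓ` (Prop. 3.3)

Buckmaster–De Lellis–Székelyhidi–Vicol, *Onsager's conjecture for admissible weak solutions*,
CPAM 72 (2019) = arXiv:1701.08678, §3.2, Prop. 3.3: for `|t - tᵢ| ≤ τ_q` and `N ≥ 0`,
`‖vᵢ - v_ℓ‖_{N+α} ≲ τ_q δ_{q+1} ℓ^{-N-1+α}`, `‖∇(p_ℓ - pᵢ)‖_{N+α} ≲ δ_{q+1} ℓ^{-N-1+α}`,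
`‖D_{t,ℓ}(vᵢ - v_ℓ)‖_{N+α} ≲ δ_{q+1} ℓ^{-N-1+α}`, `D_{t,ℓ} = ∂ₜ + v_ℓ·∇`. Proof (ibid.): with
`w = vᵢ - v_ℓ`, (3.10) `∂ₜw + (v_ℓ·∇)w = -(w·∇)vᵢ - ∇(pᵢ - p_ℓ) - div R̊_ℓ`, (3.11)
`Δ(p_ℓ - pᵢ) = div(∇v_ℓ w) + div(∇vᵢ w) + div div R̊_ℓ`, Prop. C.1 for `∇Δ⁻¹div`, the transport
estimate (B.2) and Grönwall, then induction on `N` commuting `∂^θ` with `D_{t,ℓ}`.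

This file proves Prop. 3.3 in dimensionless form from the named fact `BDSV.holderCZBound`
(Prop. C.1): the algebra — the transport equation of `w` along `v_ℓ`
(`BDSV.stability_transport_eq`), the pressure identity
`p - p_ℓ = -Δ⁻¹ div((w·∇)(v_ℓ + v) + div R̊_ℓ)` (`BDSV.stability_pressure_eq`, using
`div((v_ℓ·∇)w) = div((w·∇)v_ℓ)` for divergence-free fields) — the forcing bounds, and the
level-by-level estimate by `BDSV.eContDiffHolderNorm_transport_higher` with absorption
(`BDSV.holderCZBound.stability33`).

## References

* T. Buckmaster, C. De Lellis, L. Székelyhidi Jr., V. Vicol, *Onsager's conjecture for admissible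
  weak solutions*, Comm. Pure Appl. Math. 72 (2019) 229–274 = arXiv:1701.08678: §3.2, Prop. 3.3,
  (3.9)–(3.13).
-/

noncomputable section

open MeasureTheory Set Filter Function
open scoped NNReal ENNReal ContDiff Topology

set_option maxSynthPendingDepth 3

namespace Literature.Analysis.FluidPDE

namespace BDSV

open FunctionSpaces FunctionSpaces.Torus

/-! ## Algebra: the equations for `w = v - v_ℓ` and `p - p_ℓ` -/

section Algebra

variable {d : Type} [Fintype d] [DecidableEq d]

/-- **`div((u·∇)z) = ∑ₖᵢ ∂ₖuᵢ ∂ᵢzₖ`** for smooth `u` and smooth divergence-free `z` on the torus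
(Leibniz, Schwarz, `∑ᵢ uᵢ∂ᵢ(div z) = 0`). [folklore] -/
theorem divergence_convect_eq_sum {u z : UnitAddTorus d → EuclideanSpace ℝ d} (hu : IsSmooth u)
    (hz : IsSmooth z) (hdiv : IsDivFree z) (x : UnitAddTorus d) :
    divergence (convect u z) x = ∑ k, ∑ i, partialDeriv k u x i * partialDeriv i z x k := by
  have hu1 : IsContDiff 1 u := isContDiff_one_of_isSmooth hu
  have hz1 : IsContDiff 1 z := isContDiff_one_of_isSmooth hz
  have hui : ∀ i, IsSmooth (fun y => u y i) := fun i => hu.apply i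
  have hDiz : ∀ i k, IsSmooth (fun y => partialDeriv i z y k) := fun i k => (hz.partialDeriv i).apply k
  have hcomp : ∀ k, (fun y => convect u z y k) = fun y => ∑ i, u y i * partialDeriv i z y k := fun k =>
    funext fun y => convect_apply_coord_sum hz1 y k
  have hterm : ∀ k i, IsContDiff 1 (fun y => u y i * partialDeriv i z y k) := fun k i =>
    ((hui i).smul' (hDiz i k)).isContDiff (by simp)
  have hdiff : ∀ k, partialDeriv k (fun y => convect u z y k) x =
      ∑ i, (u x i * partialDeriv k (fun y => partialDeriv i z y k) x +
        partialDeriv k u x i * partialDeriv i z x k) := by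
    intro k
    rw [hcomp k, partialDeriv_finset_sum Finset.univ (fun i _ => hterm k i)]
    refine Finset.sum_congr rfl fun i _ => ?_
    rw [partialDeriv_mul ((hui i).isContDiff (by simp)) ((hDiz i k).isContDiff (by simp)),
      partialDeriv_apply_coord hu1]
  have hswap : ∀ k i, partialDeriv k (fun y => partialDeriv i z y k) x =
      partialDeriv i (fun y => partialDeriv k z y k) x := by
    intro k i
    rw [partialDeriv_apply_coord ((hz.partialDeriv i).isContDiff (by simp)),
      partialDeriv_comm hz k i x,
      ← partialDeriv_apply_coord ((hz.partialDeriv k).isContDiff (by simp))]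
  have hdiv0 : ∀ i, ∑ k, partialDeriv i (fun y => partialDeriv k z y k) x = 0 := by
    intro i
    have htk : ∀ k, IsContDiff 1 (fun y => partialDeriv k z y k) := fun k => (hDiz k k).isContDiff (by simp)
    rw [← partialDeriv_finset_sum Finset.univ (fun k _ => htk k)]
    have hfun : (fun y => ∑ k, partialDeriv k z y k) = fun _ => (0 : ℝ) := by
      funext y
      have h := hdiv y
      rw [divergence] at h
      rw [← h]
      exact Finset.sum_congr rfl fun k _ => (partialDeriv_apply_coord hz1 k y k).symm
    rw [hfun]
    simp [partialDeriv, FunctionSpaces.Torus.lineDeriv]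
  rw [divergence]
  simp_rw [hdiff]
  simp only [Finset.sum_add_distrib]
  have hfirst : ∑ k, ∑ i, u x i * partialDeriv k (fun y => partialDeriv i z y k) x = 0 := by
    calc ∑ k, ∑ i, u x i * partialDeriv k (fun y => partialDeriv i z y k) x
        = ∑ k, ∑ i, u x i * partialDeriv i (fun y => partialDeriv k z y k) x :=
          Finset.sum_congr rfl fun k _ => Finset.sum_congr rfl fun i _ => by rw [hswap k i]
      _ = ∑ i, ∑ k, u x i * partialDeriv i (fun y => partialDeriv k z y k) x := Finset.sum_comm
      _ = ∑ i, u x i * ∑ k, partialDeriv i (fun y => partialDeriv k z y k) x :=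
          Finset.sum_congr rfl fun i _ => (Finset.mul_sum _ _ _).symm
      _ = 0 := Finset.sum_eq_zero fun i _ => by rw [hdiv0 i, mul_zero]
  rw [hfirst, zero_add]

/-- **`div((u·∇)z) = div((z·∇)u)`** for smooth divergence-free `u, z` on the torus (both equal
`tr(Du Dz)`; BDSV (3.11): `div((v_ℓ·∇)(v_ℓ - vᵢ)) = div(∇v_ℓ (v_ℓ - vᵢ))`). [cite: BuckmasterEtAl2018, §3.2 (3.11)] -/
theorem divergence_convect_comm {u z : UnitAddTorus d → EuclideanSpace ℝ d} (hu : IsSmooth u)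
    (hz : IsSmooth z) (hdivu : IsDivFree u) (hdivz : IsDivFree z) (x : UnitAddTorus d) :
    divergence (convect u z) x = divergence (convect z u) x := by
  rw [divergence_convect_eq_sum hu hz hdivz x, divergence_convect_eq_sum hz hu hdivu x, Finset.sum_comm]
  exact Finset.sum_congr rfl fun i _ => Finset.sum_congr rfl fun k _ => mul_comm _ _

omit [DecidableEq d] in
/-- The convective derivative is additive in the differentiated field (for `C¹` fields). [folklore] -/
theorem convect_add_right {F : Type} [NormedAddCommGroup F] [NormedSpace ℝ F]
    {u : UnitAddTorus d → EuclideanSpace ℝ d} {z z' : UnitAddTorus d → F} (hz : IsContDiff 1 z)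
    (hz' : IsContDiff 1 z') (x : UnitAddTorus d) :
    convect u (z + z') x = convect u z x + convect u z' x := by
  simp only [convect]
  rw [fderiv_add hz hz', FunLike.coe_add, Pi.add_apply]

omit [DecidableEq d] in
/-- The convective derivative is subtractive in the differentiated field (for `C¹` fields). [folklore] -/
theorem convect_sub_right {F : Type} [NormedAddCommGroup F] [NormedSpace ℝ F]
    {u : UnitAddTorus d → EuclideanSpace ℝ d} {z z' : UnitAddTorus d → F} (hz : IsContDiff 1 z)
    (hz' : IsContDiff 1 z') (x : UnitAddTorus d) :
    convect u (z - z') x = convect u z x - convect u z' x := by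
  simp only [convect]
  rw [FunctionSpaces.Torus.fderiv_sub hz hz', FunLike.coe_sub, Pi.sub_apply]

omit [Fintype d] [DecidableEq d] in
/-- The convective derivative is additive in the transporting field. [folklore] -/
theorem convect_add_left {F : Type} [NormedAddCommGroup F] [NormedSpace ℝ F]
    (u u' : UnitAddTorus d → EuclideanSpace ℝ d) (z : UnitAddTorus d → F) (x : UnitAddTorus d) :
    convect (u + u') z x = convect u z x + convect u' z x := by
  simp only [convect, Pi.add_apply, map_add]

omit [Fintype d] [DecidableEq d] in
/-- The convective derivative is subtractive in the transporting field. [folklore] -/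
theorem convect_sub_left {F : Type} [NormedAddCommGroup F] [NormedSpace ℝ F]
    (u u' : UnitAddTorus d → EuclideanSpace ℝ d) (z : UnitAddTorus d → F) (x : UnitAddTorus d) :
    convect (u - u') z x = convect u z x - convect u' z x := by
  simp only [convect, Pi.sub_apply, map_sub]

end Algebra

/-! ## The equations of the difference `w = v - v_ℓ` -/

section Equations

variable {d : Type} [Fintype d] [DecidableEq d]

omit [DecidableEq d] in
/-- The one-sided time derivative of a difference of jointly smooth fields. [folklore] -/
theorem timeDerivWithin_sub' {F : Type} [NormedAddCommGroup F] [NormedSpace ℝ F] {S : Set ℝ}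
    {u u' : ℝ → UnitAddTorus d → F} (hu : IsSmoothSpaceTimeOn S u) (hu' : IsSmoothSpaceTimeOn S u')
    (hS : UniqueDiffOn ℝ S) {t : ℝ} (ht : t ∈ S) (x : UnitAddTorus d) :
    timeDerivWithin S (fun s y => u s y - u' s y) t x = timeDerivWithin S u t x - timeDerivWithin S u' t x := by
  unfold timeDerivWithin
  exact ((hu.hasDerivWithinAt_slice ht x).sub (hu'.hasDerivWithinAt_slice ht x)).derivWithin (hS t ht)

omit [DecidableEq d] in
/-- `∇(θ - θ') = ∇θ - ∇θ'` for `C¹` scalar functions on the torus. [folklore] -/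
theorem gradient_sub' {θ θ' : UnitAddTorus d → ℝ} (hθ : IsContDiff 1 θ) (hθ' : IsContDiff 1 θ')
    (x : UnitAddTorus d) : gradient (fun y => θ y - θ' y) x = gradient θ x - gradient θ' x := by
  refine ext_inner_right ℝ fun w => ?_
  rw [inner_sub_left, Torus.inner_gradient_left, Torus.inner_gradient_left, Torus.inner_gradient_left,
    show (fun y => θ y - θ' y) = θ - θ' from rfl, FunctionSpaces.Torus.fderiv_sub hθ hθ',
    FunLike.coe_sub, Pi.sub_apply]

/-- `div (u + z) = div u + div z` for `C¹` vector fields on the torus. [folklore] -/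
theorem divergence_add' {u z : UnitAddTorus d → EuclideanSpace ℝ d} (hu : IsContDiff 1 u)
    (hz : IsContDiff 1 z) (x : UnitAddTorus d) :
    divergence (u + z) x = divergence u x + divergence z x := by
  simp only [divergence, ← Finset.sum_add_distrib]
  refine Finset.sum_congr rfl fun i _ => ?_
  have hui : IsContDiff 1 (fun y => u y i) := (EuclideanSpace.proj i : EuclideanSpace ℝ d →L[ℝ] ℝ).contDiff.comp hu
  have hzi : IsContDiff 1 (fun y => z y i) := (EuclideanSpace.proj i : EuclideanSpace ℝ d →L[ℝ] ℝ).contDiff.comp hz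
  have h : (fun y => (u + z) y i) = (fun y => u y i) + fun y => z y i := by
    funext y; simp
  rw [h, partialDeriv_add hui hzi, Pi.add_apply]

variable {a b : ℝ} {vℓ v : ℝ → UnitAddTorus (Fin 3) → EuclideanSpace ℝ (Fin 3)}
  {pℓ p : ℝ → UnitAddTorus (Fin 3) → ℝ}
  {Rℓ : ℝ → UnitAddTorus (Fin 3) → Fin 3 → EuclideanSpace ℝ (Fin 3)}

/-- **The transport equation of `w = v - v_ℓ` along `v_ℓ`** (BDSV (3.10), sign of `w` reversed):
`∂ₜw + (v_ℓ·∇)w = -(w·∇)v - ∇(p - p_ℓ) - div R̊_ℓ` on `[a,b] × T³` for an exact Euler solution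
`(v, p)` and an Euler–Reynolds triple `(v_ℓ, p_ℓ, R̊_ℓ)`. [cite: BuckmasterEtAl2018, §3.2 (3.10)] -/
theorem stability_transport_eq (hab : a < b) (hℓ : Torus.IsEulerReynoldsOn (Icc a b) vℓ pℓ Rℓ)
    (hv : IsExactEulerOn (Icc a b) v p) :
    ∀ s ∈ Icc a b, ∀ x, timeDerivWithin (Icc a b) (fun t y => v t y - vℓ t y) s x +
        convect (vℓ s) (fun y => v s y - vℓ s y) x =
      -(convect (fun y => v s y - vℓ s y) (v s) x) - gradient (fun y => p s y - pℓ s y) x -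
        Torus.tensorDivergence (Rℓ s) x := by
  intro s hs x
  have hU : UniqueDiffOn ℝ (Icc a b) := uniqueDiffOn_Icc hab
  have hvs : IsSmooth (v s) := hv.smooth_velocity.isSmooth_slice hs
  have hℓs : IsSmooth (vℓ s) := hℓ.smooth_velocity.isSmooth_slice hs
  have hps : IsSmooth (p s) := hv.smooth_pressure.isSmooth_slice hs
  have hpℓs : IsSmooth (pℓ s) := hℓ.smooth_pressure.isSmooth_slice hs
  have h1 := hv.momentum s hs x
  rw [Torus.tensorDivergence_zero] at h1
  have h2 := hℓ.momentum s hs x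
  rw [timeDerivWithin_sub' hv.smooth_velocity hℓ.smooth_velocity hU hs x,
    show (fun y => v s y - vℓ s y) = v s - vℓ s from rfl,
    convect_sub_right (isContDiff_one_of_isSmooth hvs) (isContDiff_one_of_isSmooth hℓs),
    convect_sub_left, gradient_sub' (isContDiff_one_of_isSmooth hps) (isContDiff_one_of_isSmooth hpℓs)]
  have e1 : timeDerivWithin (Icc a b) v s x = -convect (v s) (v s) x - gradient (p s) x := by
    rw [← sub_eq_zero]; rw [← h1]; abel
  have e2 : timeDerivWithin (Icc a b) vℓ s x =
      Torus.tensorDivergence (Rℓ s) x - convect (vℓ s) (vℓ s) x - gradient (pℓ s) x := by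
    rw [← h2]; abel
  rw [e1, e2]
  abel

/-- `w = v - v_ℓ` is divergence free. [folklore] -/
theorem isDivFree_sub_slice (hℓ : Torus.IsEulerReynoldsOn (Icc a b) vℓ pℓ Rℓ)
    (hv : IsExactEulerOn (Icc a b) v p) {s : ℝ} (hs : s ∈ Icc a b) :
    IsDivFree (fun y => v s y - vℓ s y) := by
  intro x
  have hvs : IsSmooth (v s) := hv.smooth_velocity.isSmooth_slice hs
  have hℓs : IsSmooth (vℓ s) := hℓ.smooth_velocity.isSmooth_slice hs
  rw [show (fun y => v s y - vℓ s y) = v s - vℓ s from rfl,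
    FunctionSpaces.Torus.divergence_sub (isContDiff_one_of_isSmooth hvs) (isContDiff_one_of_isSmooth hℓs),
    hv.divFree s hs x, hℓ.divFree s hs x, sub_zero]

/-- **The pressure equation of the difference** (BDSV (3.11), with `div((v_ℓ·∇)w) = div((w·∇)v_ℓ)`):
`Δ(p - p_ℓ) = -div((w·∇)(v_ℓ + v)) - div(div R̊_ℓ)` on `[a,b] × T³`. [cite: BuckmasterEtAl2018, §3.2 (3.11)] -/
theorem stability_laplacian_pressure_eq (hab : a < b) (hℓ : Torus.IsEulerReynoldsOn (Icc a b) vℓ pℓ Rℓ)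
    (hv : IsExactEulerOn (Icc a b) v p) {s : ℝ} (hs : s ∈ Icc a b) (x : UnitAddTorus (Fin 3)) :
    laplacian (fun y => p s y - pℓ s y) x =
      -divergence (convect (fun y => v s y - vℓ s y) (vℓ s + v s)) x -
        divergence (Torus.tensorDivergence (Rℓ s)) x := by
  have hvs : IsSmooth (v s) := hv.smooth_velocity.isSmooth_slice hs
  have hℓs : IsSmooth (vℓ s) := hℓ.smooth_velocity.isSmooth_slice hs
  have hps : IsSmooth (p s) := hv.smooth_pressure.isSmooth_slice hs
  have hpℓs : IsSmooth (pℓ s) := hℓ.smooth_pressure.isSmooth_slice hs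
  have hws : IsSmooth (fun y => v s y - vℓ s y) := hvs.sub hℓs
  have hR0 : Torus.tensorDivergence (fun (_ : UnitAddTorus (Fin 3)) (_ : Fin 3) =>
      (0 : EuclideanSpace ℝ (Fin 3))) = fun _ => 0 := funext fun x => Torus.tensorDivergence_zero x
  have hLp : laplacian (p s) x = -divergence (convect (v s) (v s)) x := by
    rw [Torus.IsEulerReynoldsOn.laplacian_pressure_eq hab hv hs x, hR0, Torus.divergence_zero, zero_sub]
  have hLℓ : laplacian (pℓ s) x = divergence (Torus.tensorDivergence (Rℓ s)) x -
      divergence (convect (vℓ s) (vℓ s)) x := Torus.IsEulerReynoldsOn.laplacian_pressure_eq hab hℓ hs x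
  -- `Δ(p - p_ℓ) = Δp - Δp_ℓ`
  have hsub : laplacian (fun y => p s y - pℓ s y) x = laplacian (p s) x - laplacian (pℓ s) x := by
    have h : (fun y => p s y - pℓ s y) = p s + -pℓ s := by funext y; simp [sub_eq_add_neg]
    rw [h, laplacian_add_apply hps hpℓs.neg, laplacian_neg_apply hpℓs, ← sub_eq_add_neg]
  -- the convective terms
  have hconv : divergence (convect (v s) (v s)) x - divergence (convect (vℓ s) (vℓ s)) x =
      divergence (convect (fun y => v s y - vℓ s y) (vℓ s + v s)) x := by
    have h1 : IsContDiff 1 (v s) := isContDiff_one_of_isSmooth hvs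
    have h2 : IsContDiff 1 (vℓ s) := isContDiff_one_of_isSmooth hℓs
    have hc1 : IsContDiff 1 (convect (vℓ s) (fun y => v s y - vℓ s y)) :=
      isContDiff_one_of_isSmooth (hℓs.convect hws)
    have hc2 : IsContDiff 1 (convect (fun y => v s y - vℓ s y) (v s)) :=
      isContDiff_one_of_isSmooth (hws.convect hvs)
    have hc3 : IsContDiff 1 (convect (fun y => v s y - vℓ s y) (vℓ s)) :=
      isContDiff_one_of_isSmooth (hws.convect hℓs)
    -- `(v·∇)v - (v_ℓ·∇)v_ℓ = (v_ℓ·∇)w + (w·∇)v`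
    have hpt : convect (v s) (v s) - convect (vℓ s) (vℓ s) =
        convect (vℓ s) (fun y => v s y - vℓ s y) + convect (fun y => v s y - vℓ s y) (v s) := by
      funext y
      rw [Pi.sub_apply, Pi.add_apply, show (fun y => v s y - vℓ s y) = v s - vℓ s from rfl,
        convect_sub_right h1 h2, convect_sub_left]
      abel
    rw [← FunctionSpaces.Torus.divergence_sub (isContDiff_one_of_isSmooth (hvs.convect hvs))
      (isContDiff_one_of_isSmooth (hℓs.convect hℓs)), hpt, divergence_add' hc1 hc2,
      divergence_convect_comm hℓs hws (hℓ.divFree s hs) (isDivFree_sub_slice hℓ hv hs) x,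
      ← divergence_add' hc3 hc2]
    congr 1
    funext y
    rw [Pi.add_apply, convect_add_right h2 h1]
  rw [hsub, hLp, hLℓ, ← hconv]
  ring

/-- **The pressure difference**: `p - p_ℓ = -Δ⁻¹(div((w·∇)(v_ℓ + v)) + div(div R̊_ℓ))` (zero-mean
pressures). [cite: BuckmasterEtAl2018, §3.2 (3.11)] -/
theorem stability_pressure_eq (hab : a < b) (hℓ : Torus.IsEulerReynoldsOn (Icc a b) vℓ pℓ Rℓ)
    (hv : IsExactEulerOn (Icc a b) v p) {s : ℝ} (hs : s ∈ Icc a b) :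
    (fun y => p s y - pℓ s y) = -invLaplacian (fun x =>
      divergence (convect (fun y => v s y - vℓ s y) (vℓ s + v s)) x +
        divergence (Torus.tensorDivergence (Rℓ s)) x) := by
  have hvs : IsSmooth (v s) := hv.smooth_velocity.isSmooth_slice hs
  have hℓs : IsSmooth (vℓ s) := hℓ.smooth_velocity.isSmooth_slice hs
  have hps : IsSmooth (p s) := hv.smooth_pressure.isSmooth_slice hs
  have hpℓs : IsSmooth (pℓ s) := hℓ.smooth_pressure.isSmooth_slice hs
  have hws : IsSmooth (fun y => v s y - vℓ s y) := hvs.sub hℓs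
  have hRs : IsSmooth (Rℓ s) := hℓ.smooth_stress.isSmooth_slice hs
  have hq : IsSmooth (fun y => p s y - pℓ s y) := hps.sub hpℓs
  set B : UnitAddTorus (Fin 3) → ℝ := fun x => divergence (convect (fun y => v s y - vℓ s y) (vℓ s + v s)) x +
    divergence (Torus.tensorDivergence (Rℓ s)) x with hB
  have hBs : IsSmooth B := ((hws.convect (hℓs.add hvs)).divergence).add hRs.tensorDivergence.divergence
  have hlap : laplacian (fun y => p s y - pℓ s y) = -B := by
    funext x
    rw [stability_laplacian_pressure_eq hab hℓ hv hs x, Pi.neg_apply, hB]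
    ring
  have h0 : ∫ y, (fun y => p s y - pℓ s y) y = 0 := by
    simp only
    rw [integral_sub hps.integrable hpℓs.integrable, hv.hasZeroMean_pressure s hs,
      hℓ.hasZeroMean_pressure s hs, sub_zero]
  calc (fun y => p s y - pℓ s y) = invLaplacian (laplacian (fun y => p s y - pℓ s y)) :=
        (invLaplacian_laplacian_of_integral_eq_zero hq h0).symm
    _ = -invLaplacian B := by rw [hlap, invLaplacian_neg hBs]

end Equations

/-! ## Bounds for the forcing terms -/

section Bounds

variable {a b : ℝ} {vℓ v : ℝ → UnitAddTorus (Fin 3) → EuclideanSpace ℝ (Fin 3)}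
  {pℓ p : ℝ → UnitAddTorus (Fin 3) → ℝ}
  {Rℓ : ℝ → UnitAddTorus (Fin 3) → Fin 3 → EuclideanSpace ℝ (Fin 3)}

/-- `‖div S‖_{N,α} ≤ 3 ‖S‖_{N+1,α}` for a smooth tensor field on `T³` (columns). [folklore] -/
theorem eContDiffHolderNorm_tensorDivergence_le {S : UnitAddTorus (Fin 3) → Fin 3 → EuclideanSpace ℝ (Fin 3)}
    (hS : IsSmooth S) (N : ℕ) (α : ℝ≥0) :
    Torus.eContDiffHolderNorm N α (Torus.tensorDivergence S) ≤ 3 * Torus.eContDiffHolderNorm (N + 1) α S := by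
  have hcol : ∀ j, IsSmooth (fun y => S y j) := fun j => hS.column j
  have hfun : Torus.tensorDivergence S = ∑ j, partialDeriv j (fun y => S y j) := by
    funext x
    simp only [Torus.tensorDivergence, Finset.sum_apply]
  rw [hfun]
  have hterm : ∀ j, Torus.eContDiffHolderNorm N α (partialDeriv j (fun y => S y j)) ≤
      Torus.eContDiffHolderNorm (N + 1) α S := by
    intro j
    refine (Torus.eContDiffHolderNorm_partialDeriv_le (isContDiff_nat_of_isSmooth (hcol j) (N + 1)) j α).trans ?_
    have h := Torus.eContDiffHolderNorm_clm_comp_le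
      (ContinuousLinearMap.proj (R := ℝ) (φ := fun _ : Fin 3 => EuclideanSpace ℝ (Fin 3)) j)
      (isContDiff_nat_of_isSmooth hS (N + 1)) α
    have h1 : ‖(ContinuousLinearMap.proj (R := ℝ) (φ := fun _ : Fin 3 => EuclideanSpace ℝ (Fin 3)) j)‖ₑ ≤ 1 := by
      rw [← ofReal_norm, ← ENNReal.ofReal_one]
      refine ENNReal.ofReal_le_ofReal (ContinuousLinearMap.opNorm_le_bound _ zero_le_one fun z => ?_)
      rw [one_mul]
      exact norm_le_pi_norm z j
    calc Torus.eContDiffHolderNorm (N + 1) α (fun y => S y j) ≤ _ := h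
      _ ≤ 1 * Torus.eContDiffHolderNorm (N + 1) α S := mul_le_mul' h1 le_rfl
      _ = _ := one_mul _
  calc Torus.eContDiffHolderNorm N α (∑ j, partialDeriv j (fun y => S y j))
      ≤ ∑ j, Torus.eContDiffHolderNorm N α (partialDeriv j (fun y => S y j)) :=
        Torus.eContDiffHolderNorm_sum_le Finset.univ fun j _ => isContDiff_nat_of_isSmooth ((hcol j).partialDeriv j) N
    _ ≤ ∑ _j : Fin 3, Torus.eContDiffHolderNorm (N + 1) α S := Finset.sum_le_sum fun j _ => hterm j
    _ = 3 * Torus.eContDiffHolderNorm (N + 1) α S := by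
        simp only [Finset.sum_const, Finset.card_univ, Fintype.card_fin, nsmul_eq_mul]
        push_cast
        ring

/-- `∂ₘΔ⁻¹(div B) = ∑ₖ ∂ₘ∂ₖΔ⁻¹ Bₖ` for a smooth vector field `B` on `T³`. [folklore] -/
theorem partialDeriv_invLaplacian_divergence {B : UnitAddTorus (Fin 3) → EuclideanSpace ℝ (Fin 3)}
    (hB : IsSmooth B) (m : Fin 3) :
    partialDeriv m (invLaplacian (divergence B)) = fun x => ∑ k, rieszHessian m k (fun y => B y k) x := by
  have hBk : ∀ k, IsSmooth (fun y => B y k) := fun k => hB.apply k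
  have hdiv : divergence B = ∑ k, partialDeriv k (fun y => B y k) := by
    funext x
    simp only [divergence, Finset.sum_apply]
  rw [hdiv, invLaplacian_finset_sum Finset.univ (fun k _ => (hBk k).partialDeriv k)]
  funext x
  have hsum : (∑ k, invLaplacian (partialDeriv k (fun y => B y k))) =
      fun y => ∑ k, invLaplacian (partialDeriv k (fun y => B y k)) y := by
    funext y; simp only [Finset.sum_apply]
  rw [hsum, partialDeriv_finset_sum Finset.univ
    (fun k _ => isContDiff_one_of_isSmooth (isSmooth_invLaplacian ((hBk k).partialDeriv k)))]
  exact Finset.sum_congr rfl fun k _ =>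
    (rieszHessian_eq_partialDeriv_invLaplacian_partialDeriv (hBk k) m k x).symm

/-- **Pressure-gradient bound for the difference** (BDSV (3.12)–(3.13) before inserting the
bounds on `v_ℓ`, `vᵢ`): from `BDSV.holderCZBound`, for `0 < α < 1` and `N` there is `C` with
`‖∇(p - p_ℓ)‖_{N,α} ≤ C (‖(w·∇)(v_ℓ + v)‖_{N,α} + ‖div R̊_ℓ‖_{N,α})`. [cite: BuckmasterEtAl2018, §3.2 (3.13)] -/
theorem holderCZBound.stability_gradient_pressure_le (hCZ : holderCZBound) {α : ℝ≥0} (hα : 0 < α)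
    (hα1 : α < 1) (N : ℕ) :
    ∃ C : ℝ≥0, ∀ {a b : ℝ} (_ : a < b) {vℓ v : ℝ → UnitAddTorus (Fin 3) → EuclideanSpace ℝ (Fin 3)}
      {pℓ p : ℝ → UnitAddTorus (Fin 3) → ℝ} {Rℓ : ℝ → UnitAddTorus (Fin 3) → Fin 3 → EuclideanSpace ℝ (Fin 3)}
      (_ : Torus.IsEulerReynoldsOn (Icc a b) vℓ pℓ Rℓ) (_ : IsExactEulerOn (Icc a b) v p),
      ∀ s ∈ Icc a b, Torus.eContDiffHolderNorm N α (gradient (fun y => p s y - pℓ s y)) ≤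
        C * (Torus.eContDiffHolderNorm N α (convect (fun y => v s y - vℓ s y) (vℓ s + v s)) +
          Torus.eContDiffHolderNorm N α (Torus.tensorDivergence (Rℓ s))) := by
  obtain ⟨C, hC⟩ := hCZ.rieszHessian_le hα hα1 N
  refine ⟨9 * C, ?_⟩
  intro a b hab vℓ v pℓ p Rℓ hℓ hv s hs
  have hvs : IsSmooth (v s) := hv.smooth_velocity.isSmooth_slice hs
  have hℓs : IsSmooth (vℓ s) := hℓ.smooth_velocity.isSmooth_slice hs
  have hps : IsSmooth (p s) := hv.smooth_pressure.isSmooth_slice hs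
  have hpℓs : IsSmooth (pℓ s) := hℓ.smooth_pressure.isSmooth_slice hs
  have hws : IsSmooth (fun y => v s y - vℓ s y) := hvs.sub hℓs
  have hRs : IsSmooth (Rℓ s) := hℓ.smooth_stress.isSmooth_slice hs
  set B : UnitAddTorus (Fin 3) → EuclideanSpace ℝ (Fin 3) := fun x =>
    convect (fun y => v s y - vℓ s y) (vℓ s + v s) x + Torus.tensorDivergence (Rℓ s) x with hBdef
  have hB1 : IsSmooth (convect (fun y => v s y - vℓ s y) (vℓ s + v s)) := hws.convect (hℓs.add hvs)
  have hB2 : IsSmooth (Torus.tensorDivergence (Rℓ s)) := hRs.tensorDivergence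
  have hB : IsSmooth B := hB1.add hB2
  have hdivB : divergence B = fun x => divergence (convect (fun y => v s y - vℓ s y) (vℓ s + v s)) x +
      divergence (Torus.tensorDivergence (Rℓ s)) x := by
    funext x
    exact divergence_add' (isContDiff_one_of_isSmooth hB1) (isContDiff_one_of_isSmooth hB2) x
  have hq : (fun y => p s y - pℓ s y) = -invLaplacian (divergence B) := by
    rw [stability_pressure_eq hab hℓ hv hs, hdivB]
  -- each partial derivative of `p - p_ℓ`
  have hpm : ∀ m, Torus.eContDiffHolderNorm N α (partialDeriv m (fun y => p s y - pℓ s y)) ≤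
      3 * C * Torus.eContDiffHolderNorm N α B := by
    intro m
    have h1 : partialDeriv m (fun y => p s y - pℓ s y) = -fun x => ∑ k, rieszHessian m k (fun y => B y k) x := by
      rw [hq, ← partialDeriv_invLaplacian_divergence hB m]
      funext x
      rw [Pi.neg_apply, ← partialDeriv_neg m _ x]
      rfl
    rw [h1, Torus.eContDiffHolderNorm_neg]
    have hfun : (fun x => ∑ k, rieszHessian m k (fun y => B y k) x) = ∑ k, rieszHessian m k (fun y => B y k) := by
      funext x; simp only [Finset.sum_apply]
    rw [hfun]
    calc Torus.eContDiffHolderNorm N α (∑ k, rieszHessian m k (fun y => B y k))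
        ≤ ∑ k, Torus.eContDiffHolderNorm N α (rieszHessian m k (fun y => B y k)) :=
          Torus.eContDiffHolderNorm_sum_le Finset.univ fun k _ =>
            isContDiff_nat_of_isSmooth (isSmooth_rieszHessian (hB.apply k) m k) N
      _ ≤ ∑ _k : Fin 3, (C : ℝ≥0∞) * Torus.eContDiffHolderNorm N α B :=
          Finset.sum_le_sum fun k _ => (hC m k _ (hB.apply k)).trans
            (mul_le_mul' le_rfl (eContDiffHolderNorm_coord_le hB N α k))
      _ = 3 * C * Torus.eContDiffHolderNorm N α B := by
          simp only [Finset.sum_const, Finset.card_univ, Fintype.card_fin, nsmul_eq_mul]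
          push_cast
          ring
  have hBle : Torus.eContDiffHolderNorm N α B ≤
      Torus.eContDiffHolderNorm N α (convect (fun y => v s y - vℓ s y) (vℓ s + v s)) +
        Torus.eContDiffHolderNorm N α (Torus.tensorDivergence (Rℓ s)) :=
    Torus.eContDiffHolderNorm_add_le (isContDiff_nat_of_isSmooth hB1 N) (isContDiff_nat_of_isSmooth hB2 N)
  calc Torus.eContDiffHolderNorm N α (gradient (fun y => p s y - pℓ s y))
      ≤ ∑ m, Torus.eContDiffHolderNorm N α (partialDeriv m (fun y => p s y - pℓ s y)) :=
        eContDiffHolderNorm_gradient_le_sum (hps.sub hpℓs) N α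
    _ ≤ ∑ _m : Fin 3, 3 * (C : ℝ≥0∞) * Torus.eContDiffHolderNorm N α B := Finset.sum_le_sum fun m _ => hpm m
    _ = ((9 * C : ℝ≥0) : ℝ≥0∞) * Torus.eContDiffHolderNorm N α B := by
        simp only [Finset.sum_const, Finset.card_univ, Fintype.card_fin, nsmul_eq_mul]
        push_cast
        ring
    _ ≤ _ := mul_le_mul' le_rfl hBle

end Bounds

/-! ## The level-`N` estimate for `w = v - v_ℓ` -/

section Level

/-- **Prop. 3.3, level `N`, given the lower levels** (BDSV §3.2: the transport estimate for `∂^θw`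
with the commutator and forcing bounds (3.12)–(3.13), absorbed under the CFL smallness): from
`BDSV.holderCZBound`, `0 < α < 1`, `N` and a constant `CΦ` for the levels `< N`, there are
`c > 0`, `C ≥ 0` such that for `(v_ℓ, p_ℓ, R̊_ℓ)` Euler–Reynolds and `(v, p)` exact Euler on
`[a,b] × T³` with `v(t₀) = v_ℓ(t₀)`, `‖v_ℓ(s)‖_{m,α}, ‖v(s)‖_{m,α} ≤ U Λ^{m-1}` (`1 ≤ m ≤ N+1`),
`‖R̊_ℓ(s)‖_{N+1,α} ≤ E Λ^{N+1}`, `‖w(s)‖_{m,α} ≤ CΦ (b-a) E Λ^{m+1}` (`m < N`) and `(b-a)U ≤ c`: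
`‖w(s)‖_{N,α} ≤ C (b-a) E Λ^{N+1}` on `[a,b]`. [cite: BuckmasterEtAl2018, Prop. 3.3 (3.6)] -/
theorem holderCZBound.stability33_level (hCZ : holderCZBound) {α : ℝ≥0} (hα : 0 < α) (hα1 : α < 1)
    (N : ℕ) {CΦ : ℝ} (hCΦ : 0 ≤ CΦ) :
    ∃ c : ℝ, 0 < c ∧ ∃ C : ℝ, 0 ≤ C ∧ ∀ {a b : ℝ} (_ : a < b)
      {vℓ v : ℝ → UnitAddTorus (Fin 3) → EuclideanSpace ℝ (Fin 3)} {pℓ p : ℝ → UnitAddTorus (Fin 3) → ℝ}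
      {Rℓ : ℝ → UnitAddTorus (Fin 3) → Fin 3 → EuclideanSpace ℝ (Fin 3)}
      (_ : Torus.IsEulerReynoldsOn (Icc a b) vℓ pℓ Rℓ) (_ : IsExactEulerOn (Icc a b) v p)
      {t₀ : ℝ} (_ : t₀ ∈ Icc a b) (_ : v t₀ = vℓ t₀) {U Λ E : ℝ} (_ : 0 < U) (_ : 1 ≤ Λ) (_ : 0 ≤ E)
      (_ : ∀ s ∈ Icc a b, ∀ m, 1 ≤ m → m ≤ N + 1 →
        Torus.eContDiffHolderNorm m α (vℓ s) ≤ ENNReal.ofReal (U * Λ ^ (m - 1)))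
      (_ : ∀ s ∈ Icc a b, ∀ m, 1 ≤ m → m ≤ N + 1 →
        Torus.eContDiffHolderNorm m α (v s) ≤ ENNReal.ofReal (U * Λ ^ (m - 1)))
      (_ : ∀ s ∈ Icc a b, Torus.eContDiffHolderNorm (N + 1) α (Rℓ s) ≤ ENNReal.ofReal (E * Λ ^ (N + 1)))
      (_ : ∀ s ∈ Icc a b, ∀ m, m < N →
        Torus.eContDiffHolderNorm m α (fun y => v s y - vℓ s y) ≤ ENNReal.ofReal (CΦ * (b - a) * E * Λ ^ (m + 1)))
      (_ : (b - a) * U ≤ c),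
      ∀ s ∈ Icc a b, Torus.eContDiffHolderNorm N α (fun y => v s y - vℓ s y) ≤
        ENNReal.ofReal (C * (b - a) * E * Λ ^ (N + 1)) := by
  obtain ⟨A, hA1, hTN⟩ := eContDiffHolderNorm_transport_higher (d := Fin 3)
    (F := EuclideanSpace ℝ (Fin 3)) N
  obtain ⟨CR, hCR⟩ := hCZ.stability_gradient_pressure_le hα hα1 N
  have hA0 : 0 < A := by linarith
  obtain ⟨P₂, hP₂def⟩ : ∃ P₂ : ℝ, P₂ = 3 ^ N * ((N + 1) * 2) * (1 + CR) := ⟨_, rfl⟩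
  have hP₂0 : 0 ≤ P₂ := by rw [hP₂def]; positivity
  obtain ⟨P₁, hP₁def⟩ : ∃ P₁ : ℝ, P₁ = P₂ * (N * CΦ) + 3 * (CR + 1) + N * CΦ := ⟨_, rfl⟩
  have hP₁0 : 0 ≤ P₁ := by rw [hP₁def]; positivity
  have hden : 0 < 2 * A * P₂ + 1 := by positivity
  obtain ⟨c, hcdef⟩ : ∃ c : ℝ, c = min (1 / 2) (min (1 / A) (1 / (2 * A * P₂ + 1))) := ⟨_, rfl⟩
  have hc0 : 0 < c := by rw [hcdef]; exact lt_min (by norm_num) (lt_min (by positivity) (one_div_pos.2 hden))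
  have hc1 : c ≤ 1 / 2 := by rw [hcdef]; exact min_le_left _ _
  have hc2 : c ≤ 1 / A := by rw [hcdef]; exact (min_le_right _ _).trans (min_le_left _ _)
  have hc3 : c ≤ 1 / (2 * A * P₂ + 1) := by rw [hcdef]; exact (min_le_right _ _).trans (min_le_right _ _)
  have hcle1 : c ≤ 1 := hc1.trans (by norm_num)
  refine ⟨c, hc0, 2 * A * P₁, by positivity, ?_⟩
  intro a b hab vℓ v pℓ p Rℓ hℓ hv t₀ ht₀ hanchor U Λ E hU hΛ hE hvℓ hvv hR hΦ hc
  have hL : 0 < b - a := sub_pos.2 hab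
  set L := b - a with hLdef
  have hLU : L * U ≤ c := hc
  have hLU1 : L * U ≤ 1 := hLU.trans hcle1
  have hU0 : 0 ≤ U := hU.le
  have hΛ0 : 0 ≤ Λ := zero_le_one.trans hΛ
  have hUJ : UniqueDiffOn ℝ (Icc a b) := uniqueDiffOn_Icc hab
  have hvs : ∀ s ∈ Icc a b, IsSmooth (v s) := fun s hs => hv.smooth_velocity.isSmooth_slice hs
  have hℓs : ∀ s ∈ Icc a b, IsSmooth (vℓ s) := fun s hs => hℓ.smooth_velocity.isSmooth_slice hs
  have hRs : ∀ s ∈ Icc a b, IsSmooth (Rℓ s) := fun s hs => hℓ.smooth_stress.isSmooth_slice hs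
  -- the transported field and its forcing
  set W : ℝ → UnitAddTorus (Fin 3) → EuclideanSpace ℝ (Fin 3) := fun t y => v t y - vℓ t y with hWdef
  have hW : IsSmoothSpaceTimeOn (Icc a b) W := hv.smooth_velocity.sub hℓ.smooth_velocity
  have hWs : ∀ s ∈ Icc a b, IsSmooth (W s) := fun s hs => hW.isSmooth_slice hs
  set G : ℝ → UnitAddTorus (Fin 3) → EuclideanSpace ℝ (Fin 3) := fun s x =>
    timeDerivWithin (Icc a b) W s x + convect (vℓ s) (W s) x with hGdef
  have hG : IsSmoothSpaceTimeOn (Icc a b) G := (hW.timeDerivWithin hUJ).add (hℓ.smooth_velocity.convect hW hUJ)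
  have heq : ∀ s ∈ Icc a b, ∀ x, timeDerivWithin (Icc a b) W s x + convect (vℓ s) (W s) x = G s x :=
    fun s hs x => rfl
  have hGform : ∀ s ∈ Icc a b, G s = fun x => -(convect (W s) (v s) x) -
      gradient (fun y => p s y - pℓ s y) x - Torus.tensorDivergence (Rℓ s) x := by
    intro s hs
    funext x
    exact stability_transport_eq hab hℓ hv s hs x
  -- finiteness and the supremum `M` of the level-`N` norms of `W`
  obtain ⟨Bfin, hBfin0, hBfin⟩ := exists_forall_eContDiffHolderNorm_le_of_Icc hab N hα1.le hW
  set S := ⨆ s ∈ Icc a b, Torus.eContDiffHolderNorm N α (W s) with hSdef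
  have hSle : S ≤ ENNReal.ofReal Bfin := iSup₂_le fun s hs => hBfin s hs
  have hST : S ≠ ⊤ := ne_top_of_le_ne_top ENNReal.ofReal_ne_top hSle
  obtain ⟨M, hMdef⟩ : ∃ M : ℝ, M = S.toReal := ⟨_, rfl⟩
  have hM0 : 0 ≤ M := by rw [hMdef]; exact ENNReal.toReal_nonneg
  have hMS : ENNReal.ofReal M = S := by rw [hMdef, ENNReal.ofReal_toReal hST]
  have hWM : ∀ s ∈ Icc a b, Torus.eContDiffHolderNorm N α (W s) ≤ ENNReal.ofReal M := by
    intro s hs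
    rw [hMS]
    exact le_iSup₂ (f := fun s _ => Torus.eContDiffHolderNorm N α (W s)) s hs
  -- bounds on all the levels `≤ N` of `W`
  obtain ⟨T, hTdef⟩ : ∃ T : ℝ, T = N * CΦ * E * Λ ^ (N + 1) + U * M := ⟨_, rfl⟩
  have hT0 : 0 ≤ T := by rw [hTdef]; positivity
  have hWj : ∀ s ∈ Icc a b, ∀ j, j ≤ N →
      Torus.eContDiffHolderNorm j α (W s) * ENNReal.ofReal (U * Λ ^ (N - j)) ≤ ENNReal.ofReal T := by
    intro s hs j hj
    have hT2 : U * M ≤ T := by rw [hTdef]; exact le_add_of_nonneg_left (by positivity)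
    rcases Nat.lt_or_eq_of_le hj with hjN | hjeq
    · have hT1 : CΦ * E * Λ ^ (N + 1) * (L * U) ≤ T := by
        rw [hTdef]
        have hNpos : 0 < N := lt_of_le_of_lt (Nat.zero_le j) hjN
        have hN1 : (1 : ℝ) ≤ N := by exact_mod_cast hNpos
        have hQ : 0 ≤ CΦ * E * Λ ^ (N + 1) := by positivity
        have h1 : CΦ * E * Λ ^ (N + 1) * (L * U) ≤ CΦ * E * Λ ^ (N + 1) * 1 :=
          mul_le_mul_of_nonneg_left hLU1 hQ
        nlinarith [mul_nonneg hU0 hM0]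
      calc _ ≤ ENNReal.ofReal (CΦ * L * E * Λ ^ (j + 1)) * ENNReal.ofReal (U * Λ ^ (N - j)) :=
            mul_le_mul' (hΦ s hs j hjN) le_rfl
        _ = ENNReal.ofReal (CΦ * E * Λ ^ (N + 1) * (L * U)) := by
            rw [← ENNReal.ofReal_mul (by positivity)]
            congr 1
            have hpow : Λ ^ (j + 1) * Λ ^ (N - j) = Λ ^ (N + 1) := by rw [← pow_add]; congr 1; omega
            calc CΦ * L * E * Λ ^ (j + 1) * (U * Λ ^ (N - j)) = CΦ * E * (Λ ^ (j + 1) * Λ ^ (N - j)) * (L * U) := by ring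
              _ = _ := by rw [hpow]
        _ ≤ ENNReal.ofReal T := ENNReal.ofReal_le_ofReal hT1
    · rw [hjeq, Nat.sub_self, pow_zero, mul_one]
      calc _ ≤ ENNReal.ofReal M * ENNReal.ofReal U := mul_le_mul' (hWM s hs) le_rfl
        _ = ENNReal.ofReal (U * M) := by rw [← ENNReal.ofReal_mul hM0]; congr 1; ring
        _ ≤ ENNReal.ofReal T := ENNReal.ofReal_le_ofReal hT2
  -- the convective terms
  have hconv : ∀ s ∈ Icc a b, ∀ (u : UnitAddTorus (Fin 3) → EuclideanSpace ℝ (Fin 3)), IsSmooth u →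
      (∀ m, 1 ≤ m → m ≤ N + 1 → Torus.eContDiffHolderNorm m α u ≤ ENNReal.ofReal (2 * U * Λ ^ (m - 1))) →
      Torus.eContDiffHolderNorm N α (convect (W s) u) ≤ ENNReal.ofReal (3 ^ N * ((N + 1) * (2 * T))) := by
    intro s hs u hu hub
    have h := Torus.eContDiffHolderNorm_convect_le (u := W s) (v := u)
      (isContDiff_nat_of_isSmooth (hWs s hs) N) (isContDiff_nat_of_isSmooth hu (N + 1)) α (k := N)
    refine h.trans ?_
    have hterm : ∀ j ∈ Finset.range (N + 1), Torus.eContDiffHolderNorm j α (W s) *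
        Torus.eContDiffHolderNorm (N - j + 1) α u ≤ ENNReal.ofReal (2 * T) := by
      intro j hj
      have hjN : j ≤ N := Nat.lt_succ_iff.1 (Finset.mem_range.1 hj)
      calc _ ≤ Torus.eContDiffHolderNorm j α (W s) * ENNReal.ofReal (2 * U * Λ ^ (N - j)) := by
            refine mul_le_mul' le_rfl ?_
            have h := hub (N - j + 1) (Nat.le_add_left 1 _) (by omega)
            rwa [Nat.add_sub_cancel] at h
        _ = 2 * (Torus.eContDiffHolderNorm j α (W s) * ENNReal.ofReal (U * Λ ^ (N - j))) := by
            rw [show 2 * U * Λ ^ (N - j) = 2 * (U * Λ ^ (N - j)) by ring, ENNReal.ofReal_mul (by norm_num),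
              ENNReal.ofReal_ofNat]
            ring
        _ ≤ 2 * ENNReal.ofReal T := mul_le_mul' le_rfl (hWj s hs j hjN)
        _ = ENNReal.ofReal (2 * T) := by
            rw [ENNReal.ofReal_mul (by norm_num : (0:ℝ) ≤ 2), ENNReal.ofReal_ofNat]
    calc (3 : ℝ≥0∞) ^ N * ∑ j ∈ Finset.range (N + 1), Torus.eContDiffHolderNorm j α (W s) *
          Torus.eContDiffHolderNorm (N - j + 1) α u
        ≤ 3 ^ N * ∑ _j ∈ Finset.range (N + 1), ENNReal.ofReal (2 * T) :=
          mul_le_mul' le_rfl (Finset.sum_le_sum hterm)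
      _ = ENNReal.ofReal (3 ^ N * ((N + 1) * (2 * T))) := by
          rw [Finset.sum_const, Finset.card_range, nsmul_eq_mul]
          rw [ENNReal.ofReal_mul (by positivity : (0 : ℝ) ≤ 3 ^ N), ENNReal.ofReal_pow (by norm_num : (0 : ℝ) ≤ 3),
            ENNReal.ofReal_ofNat, ENNReal.ofReal_mul (by positivity : (0 : ℝ) ≤ (N : ℝ) + 1),
            show ((N : ℝ) + 1) = ((N + 1 : ℕ) : ℝ) by push_cast; ring, ENNReal.ofReal_natCast]
  have hvb : ∀ s ∈ Icc a b, ∀ m, 1 ≤ m → m ≤ N + 1 →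
      Torus.eContDiffHolderNorm m α (v s) ≤ ENNReal.ofReal (2 * U * Λ ^ (m - 1)) := fun s hs m hm hmN =>
    (hvv s hs m hm hmN).trans (ENNReal.ofReal_le_ofReal (by nlinarith [pow_nonneg hΛ0 (m - 1)]))
  have hsumb : ∀ s ∈ Icc a b, ∀ m, 1 ≤ m → m ≤ N + 1 →
      Torus.eContDiffHolderNorm m α (vℓ s + v s) ≤ ENNReal.ofReal (2 * U * Λ ^ (m - 1)) := by
    intro s hs m hm hmN
    refine (Torus.eContDiffHolderNorm_add_le (isContDiff_nat_of_isSmooth (hℓs s hs) m)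
      (isContDiff_nat_of_isSmooth (hvs s hs) m)).trans ?_
    rw [show 2 * U * Λ ^ (m - 1) = U * Λ ^ (m - 1) + U * Λ ^ (m - 1) by ring,
      ENNReal.ofReal_add (by positivity) (by positivity)]
    exact add_le_add (hvℓ s hs m hm hmN) (hvv s hs m hm hmN)
  -- the stress term
  have hdivR : ∀ s ∈ Icc a b, Torus.eContDiffHolderNorm N α (Torus.tensorDivergence (Rℓ s)) ≤
      ENNReal.ofReal (3 * (E * Λ ^ (N + 1))) := by
    intro s hs
    refine (eContDiffHolderNorm_tensorDivergence_le (hRs s hs) N α).trans ?_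
    rw [ENNReal.ofReal_mul (by norm_num), ENNReal.ofReal_ofNat]
    exact mul_le_mul' le_rfl (hR s hs)
  -- the forcing bound
  obtain ⟨G₀, hG₀def⟩ : ∃ G₀ : ℝ, G₀ = 3 ^ N * ((N + 1) * (2 * T)) * (1 + CR) +
      (CR + 1) * (3 * (E * Λ ^ (N + 1))) := ⟨_, rfl⟩
  have hG₀0 : 0 ≤ G₀ := by rw [hG₀def]; positivity
  have hGb : ∀ s ∈ Icc a b, Torus.eContDiffHolderNorm N α (G s) ≤ ENNReal.ofReal G₀ := by
    intro s hs
    rw [hGform s hs]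
    have hc1' : IsContDiff N (fun x => -(convect (W s) (v s) x)) :=
      isContDiff_nat_of_isSmooth ((hWs s hs).convect (hvs s hs)).neg N
    have hq : IsSmooth (gradient (fun y => p s y - pℓ s y)) :=
      ((hv.smooth_pressure.isSmooth_slice hs).sub (hℓ.smooth_pressure.isSmooth_slice hs)).gradient
    have hc2' : IsContDiff N (gradient (fun y => p s y - pℓ s y)) := isContDiff_nat_of_isSmooth hq N
    have hc3' : IsContDiff N (Torus.tensorDivergence (Rℓ s)) := isContDiff_nat_of_isSmooth (hRs s hs).tensorDivergence N
    have h12 : IsContDiff N ((fun x => -(convect (W s) (v s) x)) - gradient (fun y => p s y - pℓ s y)) := hc1'.sub hc2'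
    have hfun : (fun x => -(convect (W s) (v s) x) - gradient (fun y => p s y - pℓ s y) x -
        Torus.tensorDivergence (Rℓ s) x) =
        ((fun x => -(convect (W s) (v s) x)) - gradient (fun y => p s y - pℓ s y)) - Torus.tensorDivergence (Rℓ s) := rfl
    rw [hfun]
    have e1 : Torus.eContDiffHolderNorm N α (fun x => -(convect (W s) (v s) x)) ≤
        ENNReal.ofReal (3 ^ N * ((N + 1) * (2 * T))) := by
      rw [show (fun x => -(convect (W s) (v s) x)) = -convect (W s) (v s) from rfl, Torus.eContDiffHolderNorm_neg]
      exact hconv s hs (v s) (hvs s hs) (hvb s hs)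
    have e2 : Torus.eContDiffHolderNorm N α (gradient (fun y => p s y - pℓ s y)) ≤
        ENNReal.ofReal (CR * (3 ^ N * ((N + 1) * (2 * T)) + 3 * (E * Λ ^ (N + 1)))) := by
      refine (hCR hab hℓ hv s hs).trans ?_
      rw [ENNReal.ofReal_mul (NNReal.coe_nonneg CR), ENNReal.ofReal_coe_nnreal,
        ENNReal.ofReal_add (by positivity) (by positivity)]
      exact mul_le_mul' le_rfl (add_le_add (hconv s hs (vℓ s + v s) ((hℓs s hs).add (hvs s hs)) (hsumb s hs))
        (hdivR s hs))
    calc _ ≤ Torus.eContDiffHolderNorm N α ((fun x => -(convect (W s) (v s) x)) - gradient (fun y => p s y - pℓ s y)) +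
          Torus.eContDiffHolderNorm N α (Torus.tensorDivergence (Rℓ s)) := Torus.eContDiffHolderNorm_sub_le h12 hc3'
      _ ≤ (Torus.eContDiffHolderNorm N α (fun x => -(convect (W s) (v s) x)) +
          Torus.eContDiffHolderNorm N α (gradient (fun y => p s y - pℓ s y))) +
          Torus.eContDiffHolderNorm N α (Torus.tensorDivergence (Rℓ s)) :=
          add_le_add (Torus.eContDiffHolderNorm_sub_le hc1' hc2') le_rfl
      _ ≤ (ENNReal.ofReal (3 ^ N * ((N + 1) * (2 * T))) +
          ENNReal.ofReal (CR * (3 ^ N * ((N + 1) * (2 * T)) + 3 * (E * Λ ^ (N + 1))))) +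
          ENNReal.ofReal (3 * (E * Λ ^ (N + 1))) := add_le_add (add_le_add e1 e2) (hdivR s hs)
      _ = ENNReal.ofReal G₀ := by
          rw [← ENNReal.ofReal_add (by positivity) (by positivity), ← ENNReal.ofReal_add (by positivity) (by positivity),
            hG₀def]
          congr 1
          ring
  -- the transport data
  have hK : ∀ s ∈ Icc a b, ∀ x, ‖Torus.fderiv (vℓ s) x‖ ≤ (⟨U, hU0⟩ : ℝ≥0) := by
    intro s hs x
    have h := hvℓ s hs 1 le_rfl (Nat.le_add_left 1 N)
    rw [Nat.sub_self, pow_zero, mul_one] at h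
    exact norm_fderiv_le_of_eContDiffHolderNorm_one_le hU0 h x
  have hKL : ((⟨U, hU0⟩ : ℝ≥0) : ℝ) * (b - a) ≤ 1 / 2 := by
    change U * L ≤ 1 / 2
    rw [mul_comm]; exact hLU.trans hc1
  set V : ℕ → ℝ := fun j => U * Λ ^ (j - 1) with hVdef
  have hV0 : ∀ j, 0 ≤ V j := fun j => by positivity
  have hV : ∀ s ∈ Icc a b, ∀ j, 1 ≤ j → j ≤ N → Torus.eContDiffHolderNorm j α (vℓ s) ≤ ENNReal.ofReal (V j) :=
    fun s hs j hj hjN => hvℓ s hs j hj (hjN.trans (Nat.le_succ N))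
  have hsmall : (b - a) * V 1 * A ≤ 1 := by
    simp only [hVdef, Nat.sub_self, pow_zero, mul_one]
    calc L * U * A = A * (L * U) := by ring
      _ ≤ A * (1 / A) := mul_le_mul_of_nonneg_left (hLU.trans hc2) hA0.le
      _ = 1 := by field_simp
  set Φ : ℕ → ℝ := fun m => CΦ * L * E * Λ ^ (m + 1) with hΦdef
  have hΦ0 : ∀ m, 0 ≤ Φ m := fun m => by positivity
  have hΦ' : ∀ s ∈ Icc a b, ∀ m, 1 ≤ m → m < N → Torus.eContDiffHolderNorm m α (W s) ≤ ENNReal.ofReal (Φ m) :=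
    fun s hs m _ hmN => hΦ s hs m hmN
  have hF₀ : Torus.eContDiffHolderNorm N α (W t₀) ≤ ENNReal.ofReal 0 := by
    have hW0 : W t₀ = 0 := by
      funext y
      simp only [hWdef, hanchor, sub_self, Pi.zero_apply]
    rw [hW0, Torus.eContDiffHolderNorm_zero_fun]
    exact bot_le
  have hTN' := hTN hab hα1.le hℓ.smooth_velocity hK hKL hV0 ht₀ hV hsmall hW hG heq hΦ0 hΦ' le_rfl hG₀0 hF₀ hGb
  -- the lower-order sum
  have hlow : ∑ i ∈ Finset.range (N - 1), V (i + 2) * Φ (N - 1 - i) ≤ (N - 1 : ℕ) * (CΦ * E * Λ ^ (N + 1)) := by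
    calc ∑ i ∈ Finset.range (N - 1), V (i + 2) * Φ (N - 1 - i) ≤ ∑ _i ∈ Finset.range (N - 1), CΦ * E * Λ ^ (N + 1) := by
          refine Finset.sum_le_sum fun i hi => ?_
          have hiN : i < N - 1 := Finset.mem_range.1 hi
          simp only [hVdef, hΦdef]
          have hpow : Λ ^ (i + 2 - 1) * Λ ^ (N - 1 - i + 1) = Λ ^ (N + 1) := by rw [← pow_add]; congr 1; omega
          calc U * Λ ^ (i + 2 - 1) * (CΦ * L * E * Λ ^ (N - 1 - i + 1))
              = CΦ * E * (Λ ^ (i + 2 - 1) * Λ ^ (N - 1 - i + 1)) * (L * U) := by ring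
            _ = CΦ * E * Λ ^ (N + 1) * (L * U) := by rw [hpow]
            _ ≤ CΦ * E * Λ ^ (N + 1) * 1 := mul_le_mul_of_nonneg_left hLU1 (by positivity)
            _ = _ := mul_one _
      _ = (N - 1 : ℕ) * (CΦ * E * Λ ^ (N + 1)) := by rw [Finset.sum_const, Finset.card_range, nsmul_eq_mul]
  -- absorb
  have hN1 : (0 : ℝ) ≤ ((N - 1 : ℕ) : ℝ) := Nat.cast_nonneg _
  have hN1' : ((N - 1 : ℕ) : ℝ) ≤ N := by exact_mod_cast Nat.sub_le N 1
  obtain ⟨X, hXdef⟩ : ∃ X : ℝ, X = A * (0 + L * G₀ + L * ((N - 1 : ℕ) * (CΦ * E * Λ ^ (N + 1)))) := ⟨_, rfl⟩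
  have hX0 : 0 ≤ X := by rw [hXdef]; positivity
  have hWX : ∀ s ∈ Icc a b, Torus.eContDiffHolderNorm N α (W s) ≤ ENNReal.ofReal X := fun s hs => by
    rw [hXdef]
    exact (hTN' s hs).trans (ENNReal.ofReal_le_ofReal (mul_le_mul_of_nonneg_left
      (add_le_add le_rfl (mul_le_mul_of_nonneg_left hlow hL.le)) hA0.le))
  have hMX : M ≤ X := by
    have h1 : S ≤ ENNReal.ofReal X := iSup₂_le fun s hs => hWX s hs
    rw [← hMS] at h1
    exact (ENNReal.ofReal_le_ofReal_iff hX0).1 h1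
  -- `X = X' + θ M`, `θ ≤ 1/2`
  have hXsplit : X = A * L * (P₂ * (N * CΦ) + 3 * (CR + 1) + (N - 1 : ℕ) * CΦ) * (E * Λ ^ (N + 1)) +
      (A * (L * U) * P₂) * M := by
    rw [hXdef, hG₀def, hTdef, hP₂def]
    ring
  have hθ : A * (L * U) * P₂ ≤ 1 / 2 := by
    have h2 : (A * P₂) * (1 / (2 * A * P₂ + 1)) ≤ 1 / 2 := by
      rw [mul_one_div, div_le_iff₀ hden]; linarith
    calc A * (L * U) * P₂ = (A * P₂) * (L * U) := by ring
      _ ≤ (A * P₂) * c := mul_le_mul_of_nonneg_left hLU (by positivity)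
      _ ≤ (A * P₂) * (1 / (2 * A * P₂ + 1)) := mul_le_mul_of_nonneg_left hc3 (by positivity)
      _ ≤ 1 / 2 := h2
  have hcoef : P₂ * (N * CΦ) + 3 * (CR + 1) + (N - 1 : ℕ) * CΦ ≤ P₁ := by
    rw [hP₁def]
    have : ((N - 1 : ℕ) : ℝ) * CΦ ≤ N * CΦ := mul_le_mul_of_nonneg_right hN1' hCΦ
    linarith
  have hELN : 0 ≤ E * Λ ^ (N + 1) := by positivity
  have hM2 : M ≤ 2 * A * P₁ * L * E * Λ ^ (N + 1) := by
    have h4 : (A * (L * U) * P₂) * M ≤ (1 / 2) * M := mul_le_mul_of_nonneg_right hθ hM0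
    have h5 : A * L * (P₂ * (N * CΦ) + 3 * (CR + 1) + (N - 1 : ℕ) * CΦ) * (E * Λ ^ (N + 1)) ≤
        A * L * P₁ * (E * Λ ^ (N + 1)) :=
      mul_le_mul_of_nonneg_right (mul_le_mul_of_nonneg_left hcoef (by positivity)) hELN
    have h1 : M ≤ A * L * P₁ * (E * Λ ^ (N + 1)) + (1 / 2) * M :=
      calc M ≤ X := hMX
        _ = _ := hXsplit
        _ ≤ A * L * P₁ * (E * Λ ^ (N + 1)) + (1 / 2) * M := add_le_add h5 h4
    have h6 : M ≤ 2 * (A * L * P₁ * (E * Λ ^ (N + 1))) := by linarith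
    calc M ≤ 2 * (A * L * P₁ * (E * Λ ^ (N + 1))) := h6
      _ = 2 * A * P₁ * L * E * Λ ^ (N + 1) := by ring
  intro s hs
  exact (hWM s hs).trans (ENNReal.ofReal_le_ofReal hM2)

end Level

/-! ## Prop. 3.3: all levels -/

section AllLevels

/-- **Prop. 3.3 (3.6), all levels `≤ N̄`, dimensionless form**: from `BDSV.holderCZBound`,
`0 < α < 1` and `N̄` there are `c > 0`, `C ≥ 0` such that for `(v_ℓ, p_ℓ, R̊_ℓ)` Euler–Reynolds and
`(v, p)` exact Euler on `[a,b] × T³` with `v(t₀) = v_ℓ(t₀)`, `‖v_ℓ(s)‖_{m,α}, ‖v(s)‖_{m,α} ≤ U Λ^{m-1}`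
(`1 ≤ m ≤ N̄+1`), `‖R̊_ℓ(s)‖_{m,α} ≤ E Λ^m` (`m ≤ N̄+1`) and `(b-a)U ≤ c`:
`‖(v - v_ℓ)(s)‖_{N,α} ≤ C (b-a) E Λ^{N+1}` for `s ∈ [a,b]`, `N ≤ N̄`. (With `b - a ≤ 2τ_q`,
`Λ = ℓ⁻¹`, `E ≂ δ_{q+1}ℓ^α`, `U ≂ δ_q^{1/2}λ_qℓ^{-α}` this is (3.6).) [cite: BuckmasterEtAl2018, Prop. 3.3 (3.6)] -/
theorem holderCZBound.stability33_wbound (hCZ : holderCZBound) {α : ℝ≥0} (hα : 0 < α) (hα1 : α < 1)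
    (Nbar : ℕ) :
    ∃ c : ℝ, 0 < c ∧ ∃ C : ℝ, 0 ≤ C ∧ ∀ {a b : ℝ} (_ : a < b)
      {vℓ v : ℝ → UnitAddTorus (Fin 3) → EuclideanSpace ℝ (Fin 3)} {pℓ p : ℝ → UnitAddTorus (Fin 3) → ℝ}
      {Rℓ : ℝ → UnitAddTorus (Fin 3) → Fin 3 → EuclideanSpace ℝ (Fin 3)}
      (_ : Torus.IsEulerReynoldsOn (Icc a b) vℓ pℓ Rℓ) (_ : IsExactEulerOn (Icc a b) v p)
      {t₀ : ℝ} (_ : t₀ ∈ Icc a b) (_ : v t₀ = vℓ t₀) {U Λ E : ℝ} (_ : 0 < U) (_ : 1 ≤ Λ) (_ : 0 ≤ E)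
      (_ : ∀ s ∈ Icc a b, ∀ m, 1 ≤ m → m ≤ Nbar + 1 →
        Torus.eContDiffHolderNorm m α (vℓ s) ≤ ENNReal.ofReal (U * Λ ^ (m - 1)))
      (_ : ∀ s ∈ Icc a b, ∀ m, 1 ≤ m → m ≤ Nbar + 1 →
        Torus.eContDiffHolderNorm m α (v s) ≤ ENNReal.ofReal (U * Λ ^ (m - 1)))
      (_ : ∀ s ∈ Icc a b, ∀ m, m ≤ Nbar + 1 →
        Torus.eContDiffHolderNorm m α (Rℓ s) ≤ ENNReal.ofReal (E * Λ ^ m))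
      (_ : (b - a) * U ≤ c),
      ∀ s ∈ Icc a b, ∀ N, N ≤ Nbar → Torus.eContDiffHolderNorm N α (fun y => v s y - vℓ s y) ≤
        ENNReal.ofReal (C * (b - a) * E * Λ ^ (N + 1)) := by
  induction Nbar with
  | zero =>
    obtain ⟨c, hc0, C, hC0, hlev⟩ := hCZ.stability33_level hα hα1 0 (CΦ := 0) le_rfl
    refine ⟨c, hc0, C, hC0, ?_⟩
    intro a b hab vℓ v pℓ p Rℓ hℓ hv t₀ ht₀ hanchor U Λ E hU hΛ hE hvℓ hvv hR hc s hs N hN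
    have hN0 : N = 0 := Nat.le_zero.1 hN
    subst hN0
    exact hlev hab hℓ hv ht₀ hanchor hU hΛ hE hvℓ hvv (fun s hs => hR s hs (0 + 1) le_rfl)
      (fun s _ m hm => absurd hm (Nat.not_lt_zero m)) hc s hs
  | succ Nbar IH =>
    obtain ⟨c, hc0, C, hC0, hIH⟩ := IH
    obtain ⟨c₁, hc₁, C₁, hC₁0, hlev⟩ := hCZ.stability33_level hα hα1 (Nbar + 1) (CΦ := C) hC0
    refine ⟨min c c₁, lt_min hc0 hc₁, max C C₁, hC0.trans (le_max_left _ _), ?_⟩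
    intro a b hab vℓ v pℓ p Rℓ hℓ hv t₀ ht₀ hanchor U Λ E hU hΛ hE hvℓ hvv hR hc s hs N hN
    have hL : 0 ≤ b - a := (sub_pos.2 hab).le
    have hΛ0 : 0 ≤ Λ := zero_le_one.trans hΛ
    have hlow : ∀ s ∈ Icc a b, ∀ m, m ≤ Nbar → Torus.eContDiffHolderNorm m α (fun y => v s y - vℓ s y) ≤
        ENNReal.ofReal (C * (b - a) * E * Λ ^ (m + 1)) :=
      hIH hab hℓ hv ht₀ hanchor hU hΛ hE (fun s hs m hm hmN => hvℓ s hs m hm (hmN.trans (Nat.le_succ _)))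
        (fun s hs m hm hmN => hvv s hs m hm (hmN.trans (Nat.le_succ _)))
        (fun s hs m hmN => hR s hs m (hmN.trans (Nat.le_succ _))) (hc.trans (min_le_left _ _))
    rcases Nat.lt_or_eq_of_le hN with hNlt | hNeq
    · refine (hlow s hs N (Nat.lt_succ_iff.1 hNlt)).trans (ENNReal.ofReal_le_ofReal ?_)
      have : C ≤ max C C₁ := le_max_left _ _
      gcongr
    · rw [hNeq]
      have h := hlev hab hℓ hv ht₀ hanchor hU hΛ hE hvℓ hvv (fun s hs => hR s hs (Nbar + 1 + 1) le_rfl)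
        (fun s hs m hm => hlow s hs m (Nat.lt_succ_iff.1 hm)) (hc.trans (min_le_right _ _)) s hs
      refine h.trans (ENNReal.ofReal_le_ofReal ?_)
      have : C₁ ≤ max C C₁ := le_max_right _ _
      gcongr

/-- **Prop. 3.3 (3.7)–(3.8) at level `N`, given (3.6) up to level `N`**: from `BDSV.holderCZBound`,
`0 < α < 1`, `N` and the constant `CW` of the `w`-bounds there is `C ≥ 0` with
`‖∇(p - p_ℓ)(s)‖_{N,α} ≤ C E Λ^{N+1}` and `‖(∂ₜ + v_ℓ·∇)(v - v_ℓ)(s)‖_{N,α} ≤ C E Λ^{N+1}`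
whenever `‖v_ℓ‖_{m,α}, ‖v‖_{m,α} ≤ UΛ^{m-1}` (`1 ≤ m ≤ N+1`), `‖R̊_ℓ‖_{N+1,α} ≤ EΛ^{N+1}`,
`‖v - v_ℓ‖_{m,α} ≤ CW (b-a) E Λ^{m+1}` (`m ≤ N`) and `(b-a)U ≤ 1`. [cite: BuckmasterEtAl2018, Prop. 3.3 (3.7)–(3.8), (3.12)–(3.13)] -/
theorem holderCZBound.stability33_level_full (hCZ : holderCZBound) {α : ℝ≥0} (hα : 0 < α) (hα1 : α < 1)
    (N : ℕ) {CW : ℝ} (hCW : 0 ≤ CW) :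
    ∃ C : ℝ, 0 ≤ C ∧ ∀ {a b : ℝ} (_ : a < b)
      {vℓ v : ℝ → UnitAddTorus (Fin 3) → EuclideanSpace ℝ (Fin 3)} {pℓ p : ℝ → UnitAddTorus (Fin 3) → ℝ}
      {Rℓ : ℝ → UnitAddTorus (Fin 3) → Fin 3 → EuclideanSpace ℝ (Fin 3)}
      (_ : Torus.IsEulerReynoldsOn (Icc a b) vℓ pℓ Rℓ) (_ : IsExactEulerOn (Icc a b) v p)
      {U Λ E : ℝ} (_ : 0 < U) (_ : 1 ≤ Λ) (_ : 0 ≤ E)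
      (_ : ∀ s ∈ Icc a b, ∀ m, 1 ≤ m → m ≤ N + 1 →
        Torus.eContDiffHolderNorm m α (vℓ s) ≤ ENNReal.ofReal (U * Λ ^ (m - 1)))
      (_ : ∀ s ∈ Icc a b, ∀ m, 1 ≤ m → m ≤ N + 1 →
        Torus.eContDiffHolderNorm m α (v s) ≤ ENNReal.ofReal (U * Λ ^ (m - 1)))
      (_ : ∀ s ∈ Icc a b, Torus.eContDiffHolderNorm (N + 1) α (Rℓ s) ≤ ENNReal.ofReal (E * Λ ^ (N + 1)))
      (_ : ∀ s ∈ Icc a b, ∀ m, m ≤ N →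
        Torus.eContDiffHolderNorm m α (fun y => v s y - vℓ s y) ≤ ENNReal.ofReal (CW * (b - a) * E * Λ ^ (m + 1)))
      (_ : (b - a) * U ≤ 1),
      ∀ s ∈ Icc a b,
        Torus.eContDiffHolderNorm N α (gradient (fun y => p s y - pℓ s y)) ≤ ENNReal.ofReal (C * E * Λ ^ (N + 1)) ∧
        Torus.eContDiffHolderNorm N α (fun x => timeDerivWithin (Icc a b) (fun t y => v t y - vℓ t y) s x +
          convect (vℓ s) (fun y => v s y - vℓ s y) x) ≤ ENNReal.ofReal (C * E * Λ ^ (N + 1)) := by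
  obtain ⟨CR, hCR⟩ := hCZ.stability_gradient_pressure_le hα hα1 N
  obtain ⟨P, hPdef⟩ : ∃ P : ℝ, P = 3 ^ N * ((N + 1) * (2 * CW)) := ⟨_, rfl⟩
  have hP0 : 0 ≤ P := by rw [hPdef]; positivity
  refine ⟨P * (1 + CR) + (CR + 1) * 3, by positivity, ?_⟩
  intro a b hab vℓ v pℓ p Rℓ hℓ hv U Λ E hU hΛ hE hvℓ hvv hR hW hLU1 s hs
  have hL : 0 < b - a := sub_pos.2 hab
  set L := b - a with hLdef
  have hU0 : 0 ≤ U := hU.le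
  have hΛ0 : 0 ≤ Λ := zero_le_one.trans hΛ
  have hvs : IsSmooth (v s) := hv.smooth_velocity.isSmooth_slice hs
  have hℓs : IsSmooth (vℓ s) := hℓ.smooth_velocity.isSmooth_slice hs
  have hRs : IsSmooth (Rℓ s) := hℓ.smooth_stress.isSmooth_slice hs
  have hWs : IsSmooth (fun y => v s y - vℓ s y) := hvs.sub hℓs
  -- products of complementary orders
  obtain ⟨T, hTdef⟩ : ∃ T : ℝ, T = CW * E * Λ ^ (N + 1) := ⟨_, rfl⟩
  have hT0 : 0 ≤ T := by rw [hTdef]; positivity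
  have hWj : ∀ j, j ≤ N → Torus.eContDiffHolderNorm j α (fun y => v s y - vℓ s y) *
      ENNReal.ofReal (U * Λ ^ (N - j)) ≤ ENNReal.ofReal T := by
    intro j hj
    calc _ ≤ ENNReal.ofReal (CW * L * E * Λ ^ (j + 1)) * ENNReal.ofReal (U * Λ ^ (N - j)) :=
          mul_le_mul' (hW s hs j hj) le_rfl
      _ = ENNReal.ofReal (CW * E * Λ ^ (N + 1) * (L * U)) := by
          rw [← ENNReal.ofReal_mul (by positivity)]
          congr 1
          have hpow : Λ ^ (j + 1) * Λ ^ (N - j) = Λ ^ (N + 1) := by rw [← pow_add]; congr 1; omega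
          calc CW * L * E * Λ ^ (j + 1) * (U * Λ ^ (N - j)) = CW * E * (Λ ^ (j + 1) * Λ ^ (N - j)) * (L * U) := by ring
            _ = _ := by rw [hpow]
      _ ≤ ENNReal.ofReal T := by
          refine ENNReal.ofReal_le_ofReal ?_
          rw [hTdef]
          calc CW * E * Λ ^ (N + 1) * (L * U) ≤ CW * E * Λ ^ (N + 1) * 1 := mul_le_mul_of_nonneg_left hLU1 (by positivity)
            _ = _ := mul_one _
  have hconv : ∀ (u : UnitAddTorus (Fin 3) → EuclideanSpace ℝ (Fin 3)), IsSmooth u →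
      (∀ m, 1 ≤ m → m ≤ N + 1 → Torus.eContDiffHolderNorm m α u ≤ ENNReal.ofReal (2 * U * Λ ^ (m - 1))) →
      Torus.eContDiffHolderNorm N α (convect (fun y => v s y - vℓ s y) u) ≤ ENNReal.ofReal (3 ^ N * ((N + 1) * (2 * T))) := by
    intro u hu hub
    have h := Torus.eContDiffHolderNorm_convect_le (u := fun y => v s y - vℓ s y) (v := u)
      (isContDiff_nat_of_isSmooth hWs N) (isContDiff_nat_of_isSmooth hu (N + 1)) α (k := N)
    refine h.trans ?_
    have hterm : ∀ j ∈ Finset.range (N + 1), Torus.eContDiffHolderNorm j α (fun y => v s y - vℓ s y) *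
        Torus.eContDiffHolderNorm (N - j + 1) α u ≤ ENNReal.ofReal (2 * T) := by
      intro j hj
      have hjN : j ≤ N := Nat.lt_succ_iff.1 (Finset.mem_range.1 hj)
      calc _ ≤ Torus.eContDiffHolderNorm j α (fun y => v s y - vℓ s y) * ENNReal.ofReal (2 * U * Λ ^ (N - j)) := by
            refine mul_le_mul' le_rfl ?_
            have h := hub (N - j + 1) (Nat.le_add_left 1 _) (by omega)
            rwa [Nat.add_sub_cancel] at h
        _ = 2 * (Torus.eContDiffHolderNorm j α (fun y => v s y - vℓ s y) * ENNReal.ofReal (U * Λ ^ (N - j))) := by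
            rw [show 2 * U * Λ ^ (N - j) = 2 * (U * Λ ^ (N - j)) by ring, ENNReal.ofReal_mul (by norm_num),
              ENNReal.ofReal_ofNat]
            ring
        _ ≤ 2 * ENNReal.ofReal T := mul_le_mul' le_rfl (hWj j hjN)
        _ = ENNReal.ofReal (2 * T) := by
            rw [ENNReal.ofReal_mul (by norm_num : (0:ℝ) ≤ 2), ENNReal.ofReal_ofNat]
    calc (3 : ℝ≥0∞) ^ N * ∑ j ∈ Finset.range (N + 1), Torus.eContDiffHolderNorm j α (fun y => v s y - vℓ s y) *
          Torus.eContDiffHolderNorm (N - j + 1) α u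
        ≤ 3 ^ N * ∑ _j ∈ Finset.range (N + 1), ENNReal.ofReal (2 * T) :=
          mul_le_mul' le_rfl (Finset.sum_le_sum hterm)
      _ = ENNReal.ofReal (3 ^ N * ((N + 1) * (2 * T))) := by
          rw [Finset.sum_const, Finset.card_range, nsmul_eq_mul]
          rw [ENNReal.ofReal_mul (by positivity : (0 : ℝ) ≤ 3 ^ N), ENNReal.ofReal_pow (by norm_num : (0 : ℝ) ≤ 3),
            ENNReal.ofReal_ofNat, ENNReal.ofReal_mul (by positivity : (0 : ℝ) ≤ (N : ℝ) + 1),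
            show ((N : ℝ) + 1) = ((N + 1 : ℕ) : ℝ) by push_cast; ring, ENNReal.ofReal_natCast]
  have hvb : ∀ m, 1 ≤ m → m ≤ N + 1 →
      Torus.eContDiffHolderNorm m α (v s) ≤ ENNReal.ofReal (2 * U * Λ ^ (m - 1)) := fun m hm hmN =>
    (hvv s hs m hm hmN).trans (ENNReal.ofReal_le_ofReal (by nlinarith [pow_nonneg hΛ0 (m - 1)]))
  have hsumb : ∀ m, 1 ≤ m → m ≤ N + 1 →
      Torus.eContDiffHolderNorm m α (vℓ s + v s) ≤ ENNReal.ofReal (2 * U * Λ ^ (m - 1)) := by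
    intro m hm hmN
    refine (Torus.eContDiffHolderNorm_add_le (isContDiff_nat_of_isSmooth hℓs m)
      (isContDiff_nat_of_isSmooth hvs m)).trans ?_
    rw [show 2 * U * Λ ^ (m - 1) = U * Λ ^ (m - 1) + U * Λ ^ (m - 1) by ring,
      ENNReal.ofReal_add (by positivity) (by positivity)]
    exact add_le_add (hvℓ s hs m hm hmN) (hvv s hs m hm hmN)
  have hdivR : Torus.eContDiffHolderNorm N α (Torus.tensorDivergence (Rℓ s)) ≤ ENNReal.ofReal (3 * (E * Λ ^ (N + 1))) := by
    refine (eContDiffHolderNorm_tensorDivergence_le hRs N α).trans ?_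
    rw [ENNReal.ofReal_mul (by norm_num), ENNReal.ofReal_ofNat]
    exact mul_le_mul' le_rfl (hR s hs)
  -- (3.7)
  have hTP : 3 ^ N * ((N + 1) * (2 * T)) = P * (E * Λ ^ (N + 1)) := by rw [hPdef, hTdef]; ring
  have hgrad : Torus.eContDiffHolderNorm N α (gradient (fun y => p s y - pℓ s y)) ≤
      ENNReal.ofReal ((CR * (P + 3)) * (E * Λ ^ (N + 1))) := by
    refine (hCR hab hℓ hv s hs).trans ?_
    have h1 := hconv (vℓ s + v s) (hℓs.add hvs) hsumb
    rw [hTP] at h1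
    calc (CR : ℝ≥0∞) * (Torus.eContDiffHolderNorm N α (convect (fun y => v s y - vℓ s y) (vℓ s + v s)) +
          Torus.eContDiffHolderNorm N α (Torus.tensorDivergence (Rℓ s)))
        ≤ ENNReal.ofReal CR * (ENNReal.ofReal (P * (E * Λ ^ (N + 1))) + ENNReal.ofReal (3 * (E * Λ ^ (N + 1)))) := by
          rw [ENNReal.ofReal_coe_nnreal]
          exact mul_le_mul' le_rfl (add_le_add h1 hdivR)
      _ = ENNReal.ofReal ((CR * (P + 3)) * (E * Λ ^ (N + 1))) := by
          rw [← ENNReal.ofReal_add (by positivity) (by positivity), ← ENNReal.ofReal_mul (NNReal.coe_nonneg CR)]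
          congr 1
          ring
  have hELN : 0 ≤ E * Λ ^ (N + 1) := by positivity
  refine ⟨hgrad.trans (ENNReal.ofReal_le_ofReal ?_), ?_⟩
  · have h1 : (CR : ℝ) * (P + 3) ≤ P * (1 + CR) + (CR + 1) * 3 := by nlinarith [NNReal.coe_nonneg CR, hP0]
    calc (CR : ℝ) * (P + 3) * (E * Λ ^ (N + 1)) ≤ (P * (1 + CR) + (CR + 1) * 3) * (E * Λ ^ (N + 1)) :=
          mul_le_mul_of_nonneg_right h1 hELN
      _ = _ := by ring
  -- (3.8)
  have hform : (fun x => timeDerivWithin (Icc a b) (fun t y => v t y - vℓ t y) s x +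
      convect (vℓ s) (fun y => v s y - vℓ s y) x) =
      ((fun x => -(convect (fun y => v s y - vℓ s y) (v s) x)) - gradient (fun y => p s y - pℓ s y)) -
        Torus.tensorDivergence (Rℓ s) := by
    funext x
    rw [stability_transport_eq hab hℓ hv s hs x]
    rfl
  rw [hform]
  have hc1' : IsContDiff N (fun x => -(convect (fun y => v s y - vℓ s y) (v s) x)) :=
    isContDiff_nat_of_isSmooth (hWs.convect hvs).neg N
  have hq : IsSmooth (gradient (fun y => p s y - pℓ s y)) :=
    ((hv.smooth_pressure.isSmooth_slice hs).sub (hℓ.smooth_pressure.isSmooth_slice hs)).gradient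
  have hc2' : IsContDiff N (gradient (fun y => p s y - pℓ s y)) := isContDiff_nat_of_isSmooth hq N
  have hc3' : IsContDiff N (Torus.tensorDivergence (Rℓ s)) := isContDiff_nat_of_isSmooth hRs.tensorDivergence N
  have e1 : Torus.eContDiffHolderNorm N α (fun x => -(convect (fun y => v s y - vℓ s y) (v s) x)) ≤
      ENNReal.ofReal (P * (E * Λ ^ (N + 1))) := by
    rw [show (fun x => -(convect (fun y => v s y - vℓ s y) (v s) x)) = -convect (fun y => v s y - vℓ s y) (v s) from rfl,
      Torus.eContDiffHolderNorm_neg, ← hTP]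
    exact hconv (v s) hvs hvb
  calc _ ≤ Torus.eContDiffHolderNorm N α ((fun x => -(convect (fun y => v s y - vℓ s y) (v s) x)) -
        gradient (fun y => p s y - pℓ s y)) + Torus.eContDiffHolderNorm N α (Torus.tensorDivergence (Rℓ s)) :=
        Torus.eContDiffHolderNorm_sub_le (hc1'.sub hc2') hc3'
    _ ≤ (Torus.eContDiffHolderNorm N α (fun x => -(convect (fun y => v s y - vℓ s y) (v s) x)) +
        Torus.eContDiffHolderNorm N α (gradient (fun y => p s y - pℓ s y))) +
        Torus.eContDiffHolderNorm N α (Torus.tensorDivergence (Rℓ s)) :=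
        add_le_add (Torus.eContDiffHolderNorm_sub_le hc1' hc2') le_rfl
    _ ≤ (ENNReal.ofReal (P * (E * Λ ^ (N + 1))) + ENNReal.ofReal ((CR * (P + 3)) * (E * Λ ^ (N + 1)))) +
        ENNReal.ofReal (3 * (E * Λ ^ (N + 1))) := add_le_add (add_le_add e1 hgrad) hdivR
    _ = ENNReal.ofReal ((P * (1 + CR) + (CR + 1) * 3) * E * Λ ^ (N + 1)) := by
        rw [← ENNReal.ofReal_add (by positivity) (by positivity), ← ENNReal.ofReal_add (by positivity) (by positivity)]
        congr 1
        ring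

/-- A uniform constant for `BDSV.holderCZBound.stability33_level_full` over the levels `≤ N̄`.
[cite: BuckmasterEtAl2018, Prop. 3.3 (3.7)–(3.8)] -/
theorem holderCZBound.stability33_level_full_uniform (hCZ : holderCZBound) {α : ℝ≥0} (hα : 0 < α)
    (hα1 : α < 1) {CW : ℝ} (hCW : 0 ≤ CW) (Nbar : ℕ) :
    ∃ CF : ℝ, 0 ≤ CF ∧ ∀ N, N ≤ Nbar → ∃ C : ℝ, 0 ≤ C ∧ C ≤ CF ∧ ∀ {a b : ℝ} (_ : a < b)
      {vℓ v : ℝ → UnitAddTorus (Fin 3) → EuclideanSpace ℝ (Fin 3)} {pℓ p : ℝ → UnitAddTorus (Fin 3) → ℝ}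
      {Rℓ : ℝ → UnitAddTorus (Fin 3) → Fin 3 → EuclideanSpace ℝ (Fin 3)}
      (_ : Torus.IsEulerReynoldsOn (Icc a b) vℓ pℓ Rℓ) (_ : IsExactEulerOn (Icc a b) v p)
      {U Λ E : ℝ} (_ : 0 < U) (_ : 1 ≤ Λ) (_ : 0 ≤ E)
      (_ : ∀ s ∈ Icc a b, ∀ m, 1 ≤ m → m ≤ N + 1 →
        Torus.eContDiffHolderNorm m α (vℓ s) ≤ ENNReal.ofReal (U * Λ ^ (m - 1)))
      (_ : ∀ s ∈ Icc a b, ∀ m, 1 ≤ m → m ≤ N + 1 →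
        Torus.eContDiffHolderNorm m α (v s) ≤ ENNReal.ofReal (U * Λ ^ (m - 1)))
      (_ : ∀ s ∈ Icc a b, Torus.eContDiffHolderNorm (N + 1) α (Rℓ s) ≤ ENNReal.ofReal (E * Λ ^ (N + 1)))
      (_ : ∀ s ∈ Icc a b, ∀ m, m ≤ N →
        Torus.eContDiffHolderNorm m α (fun y => v s y - vℓ s y) ≤ ENNReal.ofReal (CW * (b - a) * E * Λ ^ (m + 1)))
      (_ : (b - a) * U ≤ 1),
      ∀ s ∈ Icc a b,
        Torus.eContDiffHolderNorm N α (gradient (fun y => p s y - pℓ s y)) ≤ ENNReal.ofReal (C * E * Λ ^ (N + 1)) ∧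
        Torus.eContDiffHolderNorm N α (fun x => timeDerivWithin (Icc a b) (fun t y => v t y - vℓ t y) s x +
          convect (vℓ s) (fun y => v s y - vℓ s y) x) ≤ ENNReal.ofReal (C * E * Λ ^ (N + 1)) := by
  induction Nbar with
  | zero =>
    obtain ⟨C, hC0, h⟩ := hCZ.stability33_level_full hα hα1 0 hCW
    exact ⟨C, hC0, fun N hN => ⟨C, hC0, le_rfl, by rw [Nat.le_zero.1 hN]; exact h⟩⟩
  | succ Nb IHb =>
    obtain ⟨CF, hCF0, hCF⟩ := IHb
    obtain ⟨C, hC0, h⟩ := hCZ.stability33_level_full hα hα1 (Nb + 1) hCW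
    refine ⟨max CF C, hCF0.trans (le_max_left _ _), fun N hN => ?_⟩
    rcases Nat.lt_or_eq_of_le hN with hlt | heq
    · obtain ⟨C', hC'0, hC'F, h'⟩ := hCF N (Nat.lt_succ_iff.1 hlt)
      exact ⟨C', hC'0, hC'F.trans (le_max_left _ _), h'⟩
    · exact ⟨C, hC0, le_max_right _ _, by rw [heq]; exact h⟩

/-- **Prop. 3.3 of BDSV in dimensionless form** (from the named fact `BDSV.holderCZBound`): for
`0 < α < 1` and `N̄` there are `c > 0`, `C ≥ 0` such that for an Euler–Reynolds triple
`(v_ℓ, p_ℓ, R̊_ℓ)` and an exact Euler solution `(v, p)` on `[a,b] × T³` with `v(t₀) = v_ℓ(t₀)`,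
`‖v_ℓ(s)‖_{m,α}, ‖v(s)‖_{m,α} ≤ U Λ^{m-1}` (`1 ≤ m ≤ N̄+1`), `‖R̊_ℓ(s)‖_{m,α} ≤ E Λ^m` (`m ≤ N̄+1`)
and `(b - a) U ≤ c`, for all `s ∈ [a,b]` and `N ≤ N̄`:
`‖(v - v_ℓ)(s)‖_{N,α} ≤ C (b-a) E Λ^{N+1}`, `‖∇(p - p_ℓ)(s)‖_{N,α} ≤ C E Λ^{N+1}`,
`‖(∂ₜ + v_ℓ·∇)(v - v_ℓ)(s)‖_{N,α} ≤ C E Λ^{N+1}`. [cite: BuckmasterEtAl2018, Prop. 3.3 (3.6)–(3.8)] -/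
theorem holderCZBound.stability33 (hCZ : holderCZBound) {α : ℝ≥0} (hα : 0 < α) (hα1 : α < 1) (Nbar : ℕ) :
    ∃ c : ℝ, 0 < c ∧ ∃ C : ℝ, 0 ≤ C ∧ ∀ {a b : ℝ} (_ : a < b)
      {vℓ v : ℝ → UnitAddTorus (Fin 3) → EuclideanSpace ℝ (Fin 3)} {pℓ p : ℝ → UnitAddTorus (Fin 3) → ℝ}
      {Rℓ : ℝ → UnitAddTorus (Fin 3) → Fin 3 → EuclideanSpace ℝ (Fin 3)}
      (_ : Torus.IsEulerReynoldsOn (Icc a b) vℓ pℓ Rℓ) (_ : IsExactEulerOn (Icc a b) v p)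
      {t₀ : ℝ} (_ : t₀ ∈ Icc a b) (_ : v t₀ = vℓ t₀) {U Λ E : ℝ} (_ : 0 < U) (_ : 1 ≤ Λ) (_ : 0 ≤ E)
      (_ : ∀ s ∈ Icc a b, ∀ m, 1 ≤ m → m ≤ Nbar + 1 →
        Torus.eContDiffHolderNorm m α (vℓ s) ≤ ENNReal.ofReal (U * Λ ^ (m - 1)))
      (_ : ∀ s ∈ Icc a b, ∀ m, 1 ≤ m → m ≤ Nbar + 1 →
        Torus.eContDiffHolderNorm m α (v s) ≤ ENNReal.ofReal (U * Λ ^ (m - 1)))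
      (_ : ∀ s ∈ Icc a b, ∀ m, m ≤ Nbar + 1 →
        Torus.eContDiffHolderNorm m α (Rℓ s) ≤ ENNReal.ofReal (E * Λ ^ m))
      (_ : (b - a) * U ≤ c),
      ∀ s ∈ Icc a b, ∀ N, N ≤ Nbar →
        Torus.eContDiffHolderNorm N α (fun y => v s y - vℓ s y) ≤ ENNReal.ofReal (C * (b - a) * E * Λ ^ (N + 1)) ∧
        Torus.eContDiffHolderNorm N α (gradient (fun y => p s y - pℓ s y)) ≤ ENNReal.ofReal (C * E * Λ ^ (N + 1)) ∧
        Torus.eContDiffHolderNorm N α (fun x => timeDerivWithin (Icc a b) (fun t y => v t y - vℓ t y) s x +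
          convect (vℓ s) (fun y => v s y - vℓ s y) x) ≤ ENNReal.ofReal (C * E * Λ ^ (N + 1)) := by
  obtain ⟨c, hc0, CW, hCW0, hWb⟩ := hCZ.stability33_wbound hα hα1 Nbar
  obtain ⟨CF, hCF0, hCF⟩ := hCZ.stability33_level_full_uniform hα hα1 hCW0 Nbar
  refine ⟨min c 1, lt_min hc0 one_pos, max CW CF, hCW0.trans (le_max_left _ _), ?_⟩
  intro a b hab vℓ v pℓ p Rℓ hℓ hv t₀ ht₀ hanchor U Λ E hU hΛ hE hvℓ hvv hR hc s hs N hN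
  have hL : 0 ≤ b - a := (sub_pos.2 hab).le
  have hΛ0 : 0 ≤ Λ := zero_le_one.trans hΛ
  have hW := hWb hab hℓ hv ht₀ hanchor hU hΛ hE hvℓ hvv hR (hc.trans (min_le_left _ _))
  obtain ⟨C, hC0, hCle, hlev⟩ := hCF N hN
  have h2 := hlev hab hℓ hv hU hΛ hE (fun s hs m hm hmN => hvℓ s hs m hm (by omega))
    (fun s hs m hm hmN => hvv s hs m hm (by omega)) (fun s hs => hR s hs (N + 1) (by omega))
    (fun s hs m hm => hW s hs m (hm.trans hN)) (hc.trans (min_le_right _ _)) s hs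
  have hELN : 0 ≤ E * Λ ^ (N + 1) := by positivity
  have hCmax : C ≤ max CW CF := hCle.trans (le_max_right _ _)
  refine ⟨(hW s hs N hN).trans (ENNReal.ofReal_le_ofReal ?_), h2.1.trans (ENNReal.ofReal_le_ofReal ?_),
    h2.2.trans (ENNReal.ofReal_le_ofReal ?_)⟩
  · have : CW ≤ max CW CF := le_max_left _ _
    gcongr
  · gcongr
  · gcongr

end AllLevels

end BDSV

end Literature.Analysis.FluidPDE
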